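import Summits.CriticalPhenomena.Ising3DConformalLimit.Theses.PrecisionLaplacian
import Summits.CriticalPhenomena.Ising3DConformalLimit.Theses.BernsteinTemperature
import Summits.CriticalPhenomena.Ising3DConformalLimit.Theses.PrimaryAtInfinity
import Summits.CriticalPhenomena.Ising3DConformalLimit.Theorems.MoebiusLimitOfTwoPointLaw.Negative.GroupLemmaNeedsTranslation
import Summits.CriticalPhenomena.Ising3DConformalLimit.Theorems.MoebiusLimitOfTwoPointLaw.Negative.CanonicalForm
import Summits.CriticalPhenomena.Ising3DConformalLimit.Theorems.MoebiusLimitOfTwoPointLaw.Negative.TwoPointConvergence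
import Summits.CriticalPhenomena.Ising3DConformalLimit.Theorems.MoebiusLimitOfTwoPointLaw.Negative.EvenReductionSharp
import Summits.CriticalPhenomena.Ising3DConformalLimit.Theorems.PrecisionLaplacianMoebiusLimitOfTwoPointLawInversionBegetsRotations
import Literature.Probability.LatticeModels.CriticalTwoPointLawDimension
import HarnessLib

/-!
# Line `two-shell-exchange-markov` of crux `MoebiusLimitOfTwoPointLaw` (item stmt-CriticalPhenomena-4801):
# the sorry-free glue and the line's reduction of the crux

Crux (by name): `Theses.PrecisionLaplacian.MoebiusLimitOfTwoPointLaw` = item 0634 (isotropic pure two-point power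
law on `ℤ³` at `β_c`) → item 1344 (non-degenerate Möbius-covariant pointwise scaling limit of `criticalCorr 3`).

This file lands, `sorry`-free and definition-free, the glue of the line skeleton
`Cruxes/MoebiusLimitOfTwoPointLaw/Lines/two_shell_exchange_markov.lean` and the exact shape to which the line
reduces the crux:

* `twoPoint_of_limit` (card P3): under the two-point law with witness `(Δ, c)`, EVERY non-degenerate pointwise
  scaling limit `(ρ, S)` of `criticalCorr 3` has `S₂(a,b) = c'‖a − b‖^{-2Δ}`, `c' = S₂(0,e₁) > 0`, with the SAME `Δ`
  (`Negative.tendsto_rho_sq_mul_rpow` + `Negative.tendstoLocallyUniformlyOn_arity_two_of_twoPointLaw` + uniqueness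
  of limits);
* `isScaleCovariant_of_limit` ("dilations are free"): such a limit, normalised off `NonCoincident`, is scale
  covariant with dimension `Δ` (`Negative.hasPointwiseScalingLimit_of_ratio_tendsto`, `tendsto_canonical_ratio`,
  `scaleCovariant_of_canonical_limit`);
* `isInversionCovariant_of_mem` (`ι₁ ∈ {ι_λ}`) and `twoShellExchange_of_moebius` (necessity of stub K1);
* `isMoebiusCovariant_of_limit_of_mem_sphereInversionCovariant`: under the two-point law, a normalised,
  translation-invariant, non-degenerate pointwise limit that is covariant under the origin-centred sphere
  inversions `ι_λ` (`S ∈ Negative.sphereInversionCovariant Δ`) is `IsMoebiusCovariant Δ` — translations by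
  hypothesis, dilations free, unit inversion = `ι₁`, and `O(3)` from translations + `ι₁` by the LANDED stub A0
  (`stub_inversionBegetsRotations`, = item 4675 `PositivityBegetsConformality.InversionBegetsRotations`);
* `moebiusLimitOfTwoPointLaw_of_sphereInversionCovariant_limits`: **the line's reduction of the crux** —
  item 5355 `PrimaryAtInfinity.ExistsRegularLimit` (existence of a regular translation-invariant limit, by name)
  together with "under the two-point law every regular limit is `ι_λ`-covariant" (the conjunction that stubs K1
  `stub_twoTimeSymmetry` and K2 `stub_traceReversibility` factor through the two-shell exchange hierarchy) imply
  the crux, under both host-route spellings.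

What is NOT here: stubs K1/K2 themselves (open: K1's irreducible member is `E_{k,m}`, `k,m ≥ 1`, `k+m` even `≥ 4`,
see `PrecisionLaplacianMoebiusLimitOfTwoPointLawTwoShellFree.lean`; K2 needs a trace/restriction theory of the
limit law on spheres that the tree does not have), and item 5355 (open: full-filter existence of the `n ≥ 4` limits).
References: crux workfile `Cruxes/MoebiusLimitOfTwoPointLaw/Disproof.lean` (§1b canonical form, §3a kinematics);
Di Francesco–Mathieu–Sénéchal 1997 §4.1, §4.3.1 [FrancescoMathieuSenechal1997].
-/

noncomputable section

namespace Summit.CriticalPhenomena.Ising3DConformalLimit.PrecisionLaplacianMoebiusLimitOfTwoPointLaw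

open Literature.Probability.LatticeModels Filter Topology
open Literature.Barriers.CriticalPhenomena.ScaleNotMoebius (twoPt injective_fin_two_iff)
open Summit.CriticalPhenomena.Ising3DConformalLimit.Theorems.MoebiusLimitOfTwoPointLaw.Negative
  (sphereInversionCovariant twoShellExchange sphereInversion_eq_smul_inversion
   mem_sphereInversionCovariant_of_scale_of_inversion mem_twoShellExchange_of_mem_sphereInversionCovariant
   tendsto_rho_sq_mul_rpow tendsto_canonical_ratio hasPointwiseScalingLimit_of_ratio_tendsto
   rescaledCorrelator_change tendstoLocallyUniformlyOn_arity_two_of_twoPointLaw scaleCovariant_of_canonical_limit)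

/-- **P3 of the card (two-point identification).** Under the two-point law with witness `(Δ, c)`, every
non-degenerate pointwise scaling limit `(ρ, S)` of `criticalCorr 3` (no positivity of `ρ` needed) has
`S₂(a,b) = c'‖a − b‖^{-2Δ}` with the SAME `Δ` and `c' = S₂(0,e₁) > 0`: along the full filter `ρ(δ)²δ^{2Δ} → S₂(0,e₁)/c` (`Negative.tendsto_rho_sq_mul_rpow`)
while the canonically renormalised pair correlator tends to `c‖a−b‖^{-2Δ}`
(`Negative.tendstoLocallyUniformlyOn_arity_two_of_twoPointLaw`); limits are unique. -/
theorem twoPoint_of_limit {Δ c : ℝ} (hc : 0 < c)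
    (hP : Tendsto (fun x : Site 3 =>
      criticalTwoPoint 3 x * Real.sqrt (∑ i, ((x i : ℝ)) ^ 2) ^ (2 * Δ)) cofinite (nhds c))
    {ρ : ℝ → ℝ} {S : CorrFamily 3}
    (hlim : HasPointwiseScalingLimit (criticalCorr 3) ρ S) (hnd : IsNondegenerateTwoPoint S) :
    ∃ c' : ℝ, 0 < c' ∧ ∀ a b : EuclideanSpace ℝ (Fin 3), a ≠ b → S 2 ![a, b] = c' * ‖a - b‖ ^ (-(2 * Δ)) := by
  set s₁ : ℝ := S 2 ![0, EuclideanSpace.single (0 : Fin 3) (1 : ℝ)] with hs₁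
  have hs₁pos : 0 < s₁ := hnd _ (zero_unitVec_mem_nonCoincident one_ne_zero)
  refine ⟨s₁, hs₁pos, fun a b hab => ?_⟩
  have hx : (![a, b] : Fin 2 → EuclideanSpace ℝ (Fin 3)) ∈ NonCoincident 3 2 := by
    rw [mem_nonCoincident, injective_fin_two_iff]
    simpa using hab
  -- the limit in the renormalisation `ρ`
  have h1 : Tendsto (fun δ => rescaledCorrelator (criticalCorr 3) ρ 2 δ ![a, b]) (𝓝[>] 0)
      (𝓝 (S 2 ![a, b])) := (hlim 2).tendsto_at hx
  -- the canonical limit (arity two is settled by `P`)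
  have h2 : Tendsto (fun δ => rescaledCorrelator (criticalCorr 3) (fun δ => δ ^ (-Δ)) 2 δ ![a, b]) (𝓝[>] 0)
      (𝓝 (c * twoPt Δ a b)) := by
    have h := (tendstoLocallyUniformlyOn_arity_two_of_twoPointLaw hc hP).tendsto_at hx
    simpa using h
  -- the ratio of the two renormalisations, squared
  have h3 : Tendsto (fun δ : ℝ => ρ δ ^ 2 * δ ^ (2 * Δ)) (𝓝[>] (0 : ℝ)) (𝓝 (s₁ / c)) :=
    tendsto_rho_sq_mul_rpow hc hP hlim
  have h4 : Tendsto (fun δ => rescaledCorrelator (criticalCorr 3) ρ 2 δ ![a, b]) (𝓝[>] 0)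
      (𝓝 (s₁ / c * (c * twoPt Δ a b))) := by
    refine (h3.mul h2).congr' ?_
    filter_upwards [self_mem_nhdsWithin] with δ hδ
    rw [Set.mem_Ioi] at hδ
    have hcan : (δ : ℝ) ^ (-Δ) ≠ 0 := (Real.rpow_pos_of_pos hδ _).ne'
    have e : (ρ δ / δ ^ (-Δ)) ^ 2 = ρ δ ^ 2 * δ ^ (2 * Δ) := by
      rw [div_pow, Real.rpow_neg hδ.le, inv_pow, div_inv_eq_mul, ← Real.rpow_mul_natCast hδ.le,
        show Δ * ((2 : ℕ) : ℝ) = 2 * Δ by push_cast; ring]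
    rw [rescaledCorrelator_change (criticalCorr 3) (ρ := fun δ => δ ^ (-Δ)) (ρ' := ρ) 2 hcan, e]
  have heq := tendsto_nhds_unique h1 h4
  rw [heq, twoPt]
  field_simp

/-- **Dilations are free.** Under the two-point law, every normalised non-degenerate pointwise limit `(ρ, S)` is
scale covariant with the two-point exponent `Δ`: `S` is `μ^{-n}` times the CANONICAL limit
(`Negative.hasPointwiseScalingLimit_of_ratio_tendsto` + `tendsto_canonical_ratio`), which is scale covariant by the
exact mesh identity `[cx/δ] = [x/(δ/c)]` (`Negative.scaleCovariant_of_canonical_limit`). -/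
theorem isScaleCovariant_of_limit {Δ c : ℝ} (hc : 0 < c)
    (hP : Tendsto (fun x : Site 3 =>
      criticalTwoPoint 3 x * Real.sqrt (∑ i, ((x i : ℝ)) ^ 2) ^ (2 * Δ)) cofinite (nhds c))
    {ρ : ℝ → ℝ} {S : CorrFamily 3} (hρ : ∀ δ ∈ Set.Ioc (0 : ℝ) 1, 0 < ρ δ)
    (hlim : HasPointwiseScalingLimit (criticalCorr 3) ρ S) (hnd : IsNondegenerateTwoPoint S)
    (hnorm : ∀ n z, z ∉ NonCoincident 3 n → S n z = 0) :
    IsScaleCovariant Δ S := by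
  set μ : ℝ := Real.sqrt (c / S 2 ![0, EuclideanSpace.single (0 : Fin 3) (1 : ℝ)]) with hμ
  have hs : 0 < S 2 ![0, EuclideanSpace.single (0 : Fin 3) (1 : ℝ)] :=
    hnd _ (zero_unitVec_mem_nonCoincident one_ne_zero)
  have hμpos : 0 < μ := Real.sqrt_pos.2 (div_pos hc hs)
  have hcan : HasPointwiseScalingLimit (criticalCorr 3) (fun δ => δ ^ (-Δ)) (fun n x => μ ^ n * S n x) :=
    hasPointwiseScalingLimit_of_ratio_tendsto hlim (fun δ hδ => (hρ δ hδ).ne')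
      (tendsto_canonical_ratio hc hP hρ hlim hnd)
  intro n k hk x
  by_cases hx : x ∈ NonCoincident 3 n
  · have key := scaleCovariant_of_canonical_limit (G := criticalCorr 3) (Δ := Δ)
      (T := fun y : Fin n → EuclideanSpace ℝ (Fin 3) => μ ^ n * S n y) (fun y hy => (hcan n).tendsto_at hy) hk hx
    have hμn : μ ^ n ≠ 0 := pow_ne_zero _ hμpos.ne'
    apply mul_left_cancel₀ hμn
    rw [key]
    ring
  · have hx' : (fun i => k • x i) ∉ NonCoincident 3 n := by
      intro h
      apply hx
      rw [mem_nonCoincident] at h ⊢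
      intro i j hij
      exact h (show k • x i = k • x j by rw [hij])
    rw [hnorm n _ hx', hnorm n x hx, mul_zero]

/-- `ι₁ ∈ {ι_λ}`: covariance under the origin-centred sphere inversions gives the tree predicate
`IsInversionCovariant Δ S` (the member `λ = 1`; the tree types the unit inversion off the origin only). -/
theorem isInversionCovariant_of_mem {Δ : ℝ} {S : CorrFamily 3} (h : S ∈ sphereInversionCovariant Δ) :
    IsInversionCovariant Δ S := by
  simp only [sphereInversionCovariant, Set.mem_setOf_eq] at h
  intro n x hx
  have key := h n 1 one_pos x hx
  have e : (fun i => (1 / ‖x i‖ ^ 2) • x i) = fun i => EuclideanGeometry.inversion 0 1 (x i) := by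
    funext i
    rw [sphereInversion_eq_smul_inversion, one_smul]
  rw [e, Real.one_rpow, one_mul] at key
  exact key

/-- NECESSITY of stub K1: a Möbius-covariant family satisfies the whole two-shell exchange hierarchy (landed
kinematics A1 + A2). So K1 claims nothing a proof of the crux could avoid. -/
theorem twoShellExchange_of_moebius {Δ : ℝ} {S : CorrFamily 3} (h : IsMoebiusCovariant Δ S) :
    S ∈ twoShellExchange Δ :=
  mem_twoShellExchange_of_mem_sphereInversionCovariant
    (mem_sphereInversionCovariant_of_scale_of_inversion h.2.1 h.2.2)

/-- **From sphere-inversion covariance to Möbius covariance, for limits under the two-point law.** A pointwise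
scaling limit `(ρ, S)` of `criticalCorr 3` that is normalised off `NonCoincident`, non-degenerate, translation
invariant and covariant under every origin-centred sphere inversion `ι_λ` is `IsMoebiusCovariant Δ` with the
two-point exponent `Δ`: dilations are free (`isScaleCovariant_of_limit`), the unit inversion is `ι₁`
(`isInversionCovariant_of_mem`), and `O(3)` follows from translations + `ι₁` by the landed group lemma
`stub_inversionBegetsRotations` (= item 4675). -/
theorem isMoebiusCovariant_of_limit_of_mem_sphereInversionCovariant {Δ c : ℝ} (hc : 0 < c)
    (hP : Tendsto (fun x : Site 3 =>
      criticalTwoPoint 3 x * Real.sqrt (∑ i, ((x i : ℝ)) ^ 2) ^ (2 * Δ)) cofinite (nhds c))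
    {ρ : ℝ → ℝ} {S : CorrFamily 3} (hρ : ∀ δ ∈ Set.Ioc (0 : ℝ) 1, 0 < ρ δ)
    (hlim : HasPointwiseScalingLimit (criticalCorr 3) ρ S)
    (hnorm : ∀ n z, z ∉ NonCoincident 3 n → S n z = 0) (hnd : IsNondegenerateTwoPoint S)
    (htr : IsTranslationInvariant S) (hsph : S ∈ sphereInversionCovariant Δ) :
    IsMoebiusCovariant Δ S := by
  have hsc : IsScaleCovariant Δ S := isScaleCovariant_of_limit hc hP hρ hlim hnd hnorm
  have hinv : IsInversionCovariant Δ S := isInversionCovariant_of_mem hsph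
  have hrot : IsRotationInvariant S := stub_inversionBegetsRotations Δ S htr hinv
  exact ⟨⟨htr, hrot⟩, hsc, hinv⟩

/-- **The line's reduction of the crux.** Item stmt-CriticalPhenomena-5355 `PrimaryAtInfinity.ExistsRegularLimit`
(BY NAME: a normalised, non-degenerate, translation- and parity-invariant pointwise limit of `criticalCorr 3`,
continuous off the diagonals, exists along the full filter) and the statement "under the two-point law every such
regular limit, once scale covariant with the two-point `Δ` and with `S₂ = c'‖·‖^{-2Δ}`, is covariant under the
origin-centred sphere inversions" (the target through which stubs K1 `stub_twoTimeSymmetry` and K2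
`stub_traceReversibility` of the skeleton factor) imply the crux `Theses.PrecisionLaplacian.MoebiusLimitOfTwoPointLaw`.
Pure composition of the glue above; `0 < c` is used (via `twoPoint_of_limit`, `isScaleCovariant_of_limit`,
`twoPointLaw_exponent_pos`). -/
theorem moebiusLimitOfTwoPointLaw_of_sphereInversionCovariant_limits
    (hE : Theses.PrimaryAtInfinity.ExistsRegularLimit)
    (hK : ∀ (Δ c : ℝ), 0 < c →
      Tendsto (fun x : Site 3 =>
        criticalTwoPoint 3 x * Real.sqrt (∑ i, ((x i : ℝ)) ^ 2) ^ (2 * Δ)) cofinite (nhds c) →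
      ∀ (ρ : ℝ → ℝ) (S : CorrFamily 3), (∀ δ ∈ Set.Ioc (0 : ℝ) 1, 0 < ρ δ) →
        HasPointwiseScalingLimit (criticalCorr 3) ρ S →
        (∀ n z, z ∉ NonCoincident 3 n → S n z = 0) →
        IsTranslationInvariant S → (∀ n, ContinuousOn (S n) (NonCoincident 3 n)) →
        IsScaleCovariant Δ S →
        (∃ c' : ℝ, 0 < c' ∧ ∀ a b : EuclideanSpace ℝ (Fin 3), a ≠ b → S 2 ![a, b] = c' * ‖a - b‖ ^ (-(2 * Δ))) →
        S ∈ sphereInversionCovariant Δ) :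
    Theses.PrecisionLaplacian.MoebiusLimitOfTwoPointLaw := by
  rintro ⟨Δ, c, hc, hP⟩
  obtain ⟨ρ, S, hρ, hlim, hnorm, hnd, htr, -, hcont⟩ := hE
  have hΔ : 0 < Δ := twoPointLaw_exponent_pos hc hP
  have h2pt := twoPoint_of_limit hc hP hlim hnd
  have hsc : IsScaleCovariant Δ S := isScaleCovariant_of_limit hc hP hρ hlim hnd hnorm
  have hsph : S ∈ sphereInversionCovariant Δ := hK Δ c hc hP ρ S hρ hlim hnorm htr hcont hsc h2pt
  exact ⟨ρ, Δ, S, hρ, hΔ, hlim, hnd,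
    isMoebiusCovariant_of_limit_of_mem_sphereInversionCovariant hc hP hρ hlim hnorm hnd htr hsph⟩

/-- The same reduction under the second host route's spelling of the crux
(`Theses.BernsteinTemperature.MoebiusLimitOfTwoPointLaw`, identical definiens). -/
theorem moebiusLimitOfTwoPointLaw_of_sphereInversionCovariant_limits'
    (hE : Theses.PrimaryAtInfinity.ExistsRegularLimit)
    (hK : ∀ (Δ c : ℝ), 0 < c →
      Tendsto (fun x : Site 3 =>
        criticalTwoPoint 3 x * Real.sqrt (∑ i, ((x i : ℝ)) ^ 2) ^ (2 * Δ)) cofinite (nhds c) →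
      ∀ (ρ : ℝ → ℝ) (S : CorrFamily 3), (∀ δ ∈ Set.Ioc (0 : ℝ) 1, 0 < ρ δ) →
        HasPointwiseScalingLimit (criticalCorr 3) ρ S →
        (∀ n z, z ∉ NonCoincident 3 n → S n z = 0) →
        IsTranslationInvariant S → (∀ n, ContinuousOn (S n) (NonCoincident 3 n)) →
        IsScaleCovariant Δ S →
        (∃ c' : ℝ, 0 < c' ∧ ∀ a b : EuclideanSpace ℝ (Fin 3), a ≠ b → S 2 ![a, b] = c' * ‖a - b‖ ^ (-(2 * Δ))) →
        S ∈ sphereInversionCovariant Δ) :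
    Theses.BernsteinTemperature.MoebiusLimitOfTwoPointLaw :=
  moebiusLimitOfTwoPointLaw_of_sphereInversionCovariant_limits hE hK

/-- **Registered lead sub-goal (after-colon form of `moebiusLimitOfTwoPointLaw_of_sphereInversionCovariant_limits`).**
The crux follows from item 5355 (by name) and sphere-inversion covariance of every regular limit under the
two-point law. -/
theorem stub_moebiusOfReversibleLimits :
    Theses.PrimaryAtInfinity.ExistsRegularLimit →
    (∀ (Δ c : ℝ), 0 < c →
      Tendsto (fun x : Site 3 =>
        criticalTwoPoint 3 x * Real.sqrt (∑ i, ((x i : ℝ)) ^ 2) ^ (2 * Δ)) cofinite (nhds c) →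
      ∀ (ρ : ℝ → ℝ) (S : CorrFamily 3), (∀ δ ∈ Set.Ioc (0 : ℝ) 1, 0 < ρ δ) →
        HasPointwiseScalingLimit (criticalCorr 3) ρ S →
        (∀ n z, z ∉ NonCoincident 3 n → S n z = 0) →
        IsTranslationInvariant S → (∀ n, ContinuousOn (S n) (NonCoincident 3 n)) →
        IsScaleCovariant Δ S →
        (∃ c' : ℝ, 0 < c' ∧ ∀ a b : EuclideanSpace ℝ (Fin 3), a ≠ b → S 2 ![a, b] = c' * ‖a - b‖ ^ (-(2 * Δ))) →
        S ∈ sphereInversionCovariant Δ) →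
    Theses.PrecisionLaplacian.MoebiusLimitOfTwoPointLaw :=
  fun hE hK => moebiusLimitOfTwoPointLaw_of_sphereInversionCovariant_limits hE hK

end Summit.CriticalPhenomena.Ising3DConformalLimit.PrecisionLaplacianMoebiusLimitOfTwoPointLaw

end
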